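import Summits.KontsevichZagierPeriods.KontsevichZagierPeriods.Theses.ZeroPortrait
import Literature.NumberTheory.Transcendental.KZCalculusProofs
import Literature.NumberTheory.Transcendental.KZUnfolding
import Literature.NumberTheory.Transcendental.KZVolumeConjectureProofs
import Literature.NumberTheory.Transcendental.KZKernelConjectureForms

/-!
# STRATEGY CENSUS checks for crux `ZeroPortrait.PencilComplete` (stmt-KontsevichZagierPeriods-11731):
the absorption theorems that make the OTHER cuts of the census piece-equivalent to the crux

Kernel-checked companion of `Cruxes/PencilComplete/STRATEGY-CENSUS.md` (crux-strategist
`cstrat-stmt-KontsevichZagierPeriods-11731-r1`, 2026-08-17). `X = PencilComplete`,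
`pencilSector = relations ⊔ closure legendrePairs ⊔ closure betaPairs`. Proved here:

* `pencilComplete_iff_kernelForm` — `X ↔ ker eval ≤ pencilSector` (the rational shape is not load-bearing);
* `pencilComplete_iff_residual` — RESIDUAL ABSORPTION: for every lever `S ≤ pencilSector`,
  `X ↔ (ker eval ≤ pencilSector ⊔ S)`: a cut "lever `S ≤ pencilSector` ∧ residual" has its residual `= X`;
* `pencilComplete_iff_zeroForm` — ZERO ABSORPTION: `X ↔` every SINGLE representation of value `0` lies in
  `pencilSector`; so any piece saying "value-zero / algebraically-valued representations are accessible"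
  (degree-compression, accessibility-of-algebraic-values cuts) already implies `X`;
* `pencilComplete_iff_dimGe` — the DIMENSION FILTRATION COLLAPSES: for every `d`, `X ↔` its restriction to
  pairs of representations both of dimension `≥ d` (slabs, `KZ.IntegralRep.exists_equivalent_of_le`), so no
  cut by dimension has a top piece weaker than `X`;
* `pencilComplete_of_summit` — `X` is summit-implied (so `X` is never harder than the summit, and the
  volume / semi-canonical forms of the SUMMIT, `KZ.kzPeriodConjecture'_iff_volumeConjectureCompact_holds`,
  are not cuts of `X`).
-/

noncomputable section

set_option linter.dupNamespace false

namespace Summit.KontsevichZagierPeriods.KontsevichZagierPeriods.Cruxes.PencilComplete.CensusChecks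

open MeasureTheory Set
open Literature.NumberTheory.Transcendental
open Literature.NumberTheory.Transcendental.KZ
open Summit.KontsevichZagierPeriods.KontsevichZagierPeriods.Theses.ZeroPortrait (PencilComplete)

/-- The pencil sector of route ZeroPortrait (verbatim). [folklore] -/
def pencilSector : AddSubgroup FormalRep :=
  Literature.NumberTheory.Transcendental.KZ.relations ⊔ AddSubgroup.closure {d | ∃ (a b c s : ℚ) (r : Literature.NumberTheory.Transcendental.KZ.IntegralRep 2) (r' : Literature.NumberTheory.Transcendental.KZ.IntegralRep 1), 0 < s ∧ s < 1 ∧ r.domain = {x | ∀ i, x i ∈ Set.Ioo (0:ℝ) 1} ∧ Set.EqOn r.integrand (fun x => (a : ℝ) * (1 / Real.sqrt ((1 - x 0 ^ 2) * (1 - (s : ℝ) * x 0 ^ 2)) * (1 / Real.sqrt ((1 - x 1 ^ 2) * (1 - (s : ℝ) * x 1 ^ 2)))) + (b : ℝ) * (Real.sqrt (1 - (s : ℝ) * x 0 ^ 2) / Real.sqrt (1 - x 0 ^ 2) * (1 / Real.sqrt ((1 - x 1 ^ 2) * (1 - (s : ℝ) * x 1 ^ 2)))) + (c : ℝ) * (Real.sqrt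 (1 - (s : ℝ) * x 0 ^ 2) / Real.sqrt (1 - x 0 ^ 2) * (Real.sqrt (1 - (s : ℝ) * x 1 ^ 2) / Real.sqrt (1 - x 1 ^ 2)))) r.domain ∧ r'.domain = Set.univ ∧ Set.EqOn r'.integrand (fun x => 1 / (2 * (1 + x 0 ^ 2))) r'.domain ∧ r.value = r'.value ∧ d = Literature.NumberTheory.Transcendental.KZ.of r - Literature.NumberTheory.Transcendental.KZ.of r'} ⊔ AddSubgroup.closure {d | ∃ (s : ℚ) (r r' : Literature.NumberTheory.Transcendental.KZ.IntegralRep 2), 0 < s ∧ r.domain = {x | ∀ i, x i ∈ Set.Ioo (0:ℝ) 1} ∧ Set.EqOn r.integrand (fun x => (x 0) ^ ((s : ℝ) - 1) * (1 - x 0) ^ (-(5:ℝ)/9) * (x 1) ^ (-(4:ℝ)/9) * (1 - x 1) ^ (-(2:ℝ)/9)) r.domain ∧ r'.domain = {x | x 0 ^ 2 + x 1 ^ 2 < 4} ∧ Set.EqOn r'.integrand (fun _ => (3:ℝ) ^ ((7:ℝ)/6) / 2) r'.domain ∧ r.value = r'.value ∧ d = Literature.NumberTheory.Transcendental.KZ.of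 r - Literature.NumberTheory.Transcendental.KZ.of r'}

/-- The crux, unfolded through the bridge. [folklore] -/
theorem pencilComplete_iff :
    PencilComplete ↔ ∀ ⦃n m : ℕ⦄ (ρ : IntegralRep n) (ρ' : IntegralRep m), ρ.IsRational → ρ'.IsRational →
      ρ.value = ρ'.value → of ρ - of ρ' ∈ pencilSector :=
  Iff.rfl

/-- `relations ≤ pencilSector`. [folklore] -/
theorem relations_le_pencilSector : relations ≤ pencilSector :=
  le_sup_left.trans le_sup_left

/-- Every generator of the pencil sector evaluates to `0`. [folklore] -/
theorem pencilSector_le_ker_eval : pencilSector ≤ eval.ker := by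
  refine sup_le (sup_le (fun c hc => relations_le_ker_eval_holds hc) ((AddSubgroup.closure_le _).mpr ?_))
    ((AddSubgroup.closure_le _).mpr ?_)
  · rintro d ⟨a, b, c, s, r, r', -, -, -, -, -, -, hval, rfl⟩
    rw [SetLike.mem_coe, AddMonoidHom.mem_ker, eval_of_sub_of, hval, sub_self]
  · rintro d ⟨s, r, r', -, -, -, -, -, hval, rfl⟩
    rw [SetLike.mem_coe, AddMonoidHom.mem_ker, eval_of_sub_of, hval, sub_self]

/-- **The summit implies the crux.** [folklore] -/
theorem pencilComplete_of_summit (hS : KontsevichZagierPeriods) : PencilComplete := by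
  rw [pencilComplete_iff]
  intro n m ρ ρ' hρ hρ' hv
  exact relations_le_pencilSector (hS ρ ρ' hρ hρ' hv)

/-- **Kernel form of the crux.** [cite: KontsevichZagier2001, §1.1] -/
theorem kernelForm_of_pencilComplete (h : PencilComplete) (c : FormalRep) (hc : eval c = 0) :
    c ∈ pencilSector := by
  obtain ⟨n, m, r, r', hrel⟩ := exists_integralRep_sub_holds c
  obtain ⟨N, R, hR, hrR⟩ := exists_isRational_equivalent_holds r
  obtain ⟨N', R', hR', hrR'⟩ := exists_isRational_equivalent_holds r'
  have hv : r.value = r'.value := by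
    have h0 : eval (c - (of r - of r')) = 0 := relations_le_ker_eval_holds hrel
    rw [map_sub, hc, zero_sub, neg_eq_zero, eval_of_sub_of, sub_eq_zero] at h0
    exact h0
  have hvR : R.value = R'.value := by
    rw [← Equivalent.value_eq_holds hrR, ← Equivalent.value_eq_holds hrR', hv]
  have hRR' : of R - of R' ∈ pencilSector := (pencilComplete_iff.mp h) R R' hR hR' hvR
  have h1 : of r - of R ∈ pencilSector := relations_le_pencilSector hrR
  have h2 : of r' - of R' ∈ pencilSector := relations_le_pencilSector hrR'
  have : c = (c - (of r - of r')) + (of r - of R) - (of r' - of R') + (of R - of R') := by abel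
  rw [this]
  exact pencilSector.add_mem (pencilSector.sub_mem (pencilSector.add_mem
    (relations_le_pencilSector hrel) h1) h2) hRR'

/-- **Crux ⇔ kernel form.** [folklore] -/
theorem pencilComplete_iff_kernelForm :
    PencilComplete ↔ ∀ c : FormalRep, eval c = 0 → c ∈ pencilSector := by
  refine ⟨kernelForm_of_pencilComplete, fun h => ?_⟩
  rw [pencilComplete_iff]
  intro n m ρ ρ' _ _ hv
  exact h _ (by rw [eval_of_sub_of, hv, sub_self])

/-! ## Residual absorption -/

/-- **Residual absorption.** For every lever `S ≤ pencilSector` the residual statement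
`ker eval ≤ pencilSector ⊔ S` IS the crux. [folklore] -/
theorem pencilComplete_iff_residual {S : AddSubgroup FormalRep} (hS : S ≤ pencilSector) :
    PencilComplete ↔ ∀ c : FormalRep, eval c = 0 → c ∈ pencilSector ⊔ S := by
  rw [pencilComplete_iff_kernelForm, sup_eq_left.mpr hS]

/-! ## Zero absorption -/

/-- **Zero form ⇒ crux.** [folklore] -/
theorem pencilComplete_of_zeroForm
    (h : ∀ (N : ℕ) (R : IntegralRep N), R.value = 0 → of R ∈ pencilSector) : PencilComplete := by
  rw [pencilComplete_iff_kernelForm]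
  intro c hc0
  obtain ⟨n, m, r, r', hrel⟩ := exists_integralRep_sub_holds c
  have hneg : of r' + of r'.neg ∈ relations := levelRel_le_relations (of_add_of_neg_mem_levelRel r')
  obtain ⟨K, R, hR⟩ := r.exists_of_add_of_sub_of_mem_relations r'.neg
  have hcR : c - of R ∈ relations := by
    have : c - of R = (c - (of r - of r')) - (of r' + of r'.neg) + (of r + of r'.neg - of R) := by abel
    rw [this]
    exact relations.add_mem (relations.sub_mem hrel hneg) hR
  have hR0 : R.value = 0 := by
    have h := relations_le_ker_eval_holds hcR
    rw [AddMonoidHom.mem_ker, map_sub, hc0, zero_sub, neg_eq_zero, eval_of] at h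
    exact h
  have : c = (c - of R) + of R := by abel
  rw [this]
  exact pencilSector.add_mem (relations_le_pencilSector hcR) (h K R hR0)

/-- **Crux ⇔ zero form.** [folklore] -/
theorem pencilComplete_iff_zeroForm :
    PencilComplete ↔ ∀ (N : ℕ) (R : IntegralRep N), R.value = 0 → of R ∈ pencilSector := by
  refine ⟨fun h N R hR => ?_, pencilComplete_of_zeroForm⟩
  have : eval (of R) = 0 := by rw [eval_of, hR]
  exact kernelForm_of_pencilComplete h _ this

/-! ## The dimension filtration collapses -/

/-- **Dimension collapse.** For every `d`, the crux is equivalent to its restriction to pairs of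
representations BOTH of dimension `≥ d` (raise dimensions by slabs). [folklore] -/
theorem pencilComplete_iff_dimGe (d : ℕ) :
    PencilComplete ↔ ∀ (n m : ℕ) (r : IntegralRep n) (r' : IntegralRep m), d ≤ n → d ≤ m →
      r.value = r'.value → of r - of r' ∈ pencilSector := by
  constructor
  · intro h n m r r' _ _ hv
    exact kernelForm_of_pencilComplete h _ (by rw [eval_of_sub_of, hv, sub_self])
  · intro h
    rw [pencilComplete_iff_kernelForm]
    intro c hc
    obtain ⟨n, m, r, r', hrel⟩ := exists_integralRep_sub_holds c
    have hv : r.value = r'.value := by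
      have h0 : eval (c - (of r - of r')) = 0 := relations_le_ker_eval_holds hrel
      rw [map_sub, hc, zero_sub, neg_eq_zero, eval_of_sub_of, sub_eq_zero] at h0
      exact h0
    obtain ⟨R, hrR⟩ := r.exists_equivalent_of_le (N := n + m + d) (by omega)
    obtain ⟨R', hrR'⟩ := r'.exists_equivalent_of_le (N := n + m + d) (by omega)
    have hvR : R.value = R'.value := by
      rw [← Equivalent.value_eq_holds hrR, ← Equivalent.value_eq_holds hrR', hv]
    have hRR' : of R - of R' ∈ pencilSector := h _ _ R R' (by omega) (by omega) hvR
    have : c = (c - (of r - of r')) + (of r - of R) - (of r' - of R') + (of R - of R') := by abel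
    rw [this]
    exact pencilSector.add_mem (pencilSector.sub_mem (pencilSector.add_mem
      (relations_le_pencilSector hrel) (relations_le_pencilSector hrR)) (relations_le_pencilSector hrR')) hRR'

/-- The summit's volume form is a reformulation of the SUMMIT, recorded here by name so the census can
cite it: `KZ.kzPeriodConjecture'_iff_volumeConjectureCompact_holds`. [folklore] -/
example := @kzPeriodConjecture'_iff_volumeConjectureCompact_holds

end Summit.KontsevichZagierPeriods.KontsevichZagierPeriods.Cruxes.PencilComplete.CensusChecks
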